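import Summits.MatrixMultiplication.MatrixMultiplication.Theorems.OutsiderSandwichDieudonne
import HarnessLib

/-!
# The level-`N` rate of `C₁` over `⟨2,2,2⟩` is at least `1 + 2^{-N}`, unconditionally

Route `OutsiderSandwich` (decomposition cell `decomp-mm`, lens 4 «minimal counterexample /
extremal reduction», gen 28, addendum), support for the aside leaf `BlockOneIsMM`
(stmt-MatrixMultiplication-27147).  Third rung of the ladder
`OutsiderSandwichLevelRate` (`2n² − 2`) → `OutsiderSandwichLevelRateTwo` (`2n² − 4`) → here
(`2n² − 2n`), fed by Dieudonné's theorem (`OutsiderSandwichDieudonne.finrank_add_card_le`).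

* `pairRank_add_two_card_le` — **core bound `2n² − 2n`**: for `n ≥ 2`, a space `L` of pairs of
  `n × n` matrices with `V · Y = 0` on `L` has `dim π₁L + dim π₂L + 2n ≤ 2n²`.
* `rate_law₃` — `Amortised N B m ⟹ (2^N + 1)·m ≤ 2^N·B` (`N ≥ 1`), via the level-`N` reduction
  `OutsiderSandwichLevelLaw.level_law`; at `N = 1` this is the exact level-one law `3m ≤ 2B`.
* `level_two_rate₃ : 5m ≤ 4·a(2, m)`, `amortisedNumber_two_five : a(2,5) ≥ 7`,
  `not_amortised_two_6_5`.

The remaining gap to the conjectural `3m ≤ 2B` at every level is exactly the gap between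
Dieudonné's bound `n² − n` for singular subspaces and the Flanders–Meshulam bound for the
annihilated pair space itself.

## References
* D. Coppersmith, S. Winograd, *Matrix multiplication via arithmetic progressions*,
  J. Symbolic Comput. 9 (1990) 251–280, §7. [CoppersmithWinograd1990]
* P. Bürgisser, M. Clausen, M. A. Shokrollahi, *Algebraic Complexity Theory*, Springer (1997),
  §17.1. [BurgisserClausenShokrollahi1997]
-/

noncomputable section
open scoped BigOperators Matrix
set_option linter.dupNamespace false
set_option autoImplicit false

namespace Summit.MatrixMultiplication.MatrixMultiplication.Theorems.OutsiderSandwichLevelRateThree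

open Literature.Computability.AlgebraicComplexity
open Summit.MatrixMultiplication.MatrixMultiplication.Theorems.OutsiderSandwichAmortised
open Summit.MatrixMultiplication.MatrixMultiplication.Theorems.OutsiderSandwichAmortisedTable
open Summit.MatrixMultiplication.MatrixMultiplication.Theorems.OutsiderSandwichLevelLaw
open Summit.MatrixMultiplication.MatrixMultiplication.Theorems.OutsiderSandwichDieudonne

/-! ## 1. The core bound `2n² − 2n` -/

section Core

variable {ρ : Type} [Fintype ρ] [DecidableEq ρ]

/-- A right-invertible first component on `L` kills the second projection. [folklore] -/
theorem snd_eq_bot_of_unit (L : Submodule ℂ (Matrix ρ ρ ℂ × Matrix ρ ρ ℂ))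
    (hL : ∀ x ∈ L, x.1 * x.2 = 0) {x : Matrix ρ ρ ℂ × Matrix ρ ρ ℂ} (hx : x ∈ L)
    {B : Matrix ρ ρ ℂ} (hB : x.1 * B = 1) :
    L.map (LinearMap.snd ℂ (Matrix ρ ρ ℂ) (Matrix ρ ρ ℂ)) = ⊥ := by
  have hB' : B * x.1 = 1 := mul_eq_one_comm.1 hB
  have hx2 : x.2 = 0 := by
    rw [← one_mul x.2, ← hB', mul_assoc, hL x hx, mul_zero]
  rw [Submodule.eq_bot_iff]
  intro y hy
  obtain ⟨z, hz, rfl⟩ := Submodule.mem_map.1 hy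
  have e := hL (x + z) (L.add_mem hx hz)
  rw [Prod.fst_add, Prod.snd_add, hx2, zero_add, add_mul, hL z hz, add_zero] at e
  show z.2 = 0
  rw [← one_mul z.2, ← hB', mul_assoc, e, mul_zero]

/-- A right-invertible second component on `L` kills the first projection. [folklore] -/
theorem fst_eq_bot_of_unit (L : Submodule ℂ (Matrix ρ ρ ℂ × Matrix ρ ρ ℂ))
    (hL : ∀ x ∈ L, x.1 * x.2 = 0) {x : Matrix ρ ρ ℂ × Matrix ρ ρ ℂ} (hx : x ∈ L)
    {B : Matrix ρ ρ ℂ} (hB : x.2 * B = 1) :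
    L.map (LinearMap.fst ℂ (Matrix ρ ρ ℂ) (Matrix ρ ρ ℂ)) = ⊥ := by
  have hx1 : x.1 = 0 := by
    rw [← mul_one x.1, ← hB, ← mul_assoc, hL x hx, zero_mul]
  rw [Submodule.eq_bot_iff]
  intro y hy
  obtain ⟨z, hz, rfl⟩ := Submodule.mem_map.1 hy
  have e := hL (x + z) (L.add_mem hx hz)
  rw [Prod.fst_add, Prod.snd_add, hx1, zero_add, mul_add, hL z hz, add_zero] at e
  show z.1 = 0
  rw [← mul_one z.1, ← hB, ← mul_assoc, e, zero_mul]

/-- **Core bound `2n² − 2n`.**  For `n ≥ 2`, a space `L` of pairs of `n × n` matrices with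
`V · Y = 0` on `L` has `dim π₁L + dim π₂L + 2n ≤ 2n²`.
[cite: BurgisserClausenShokrollahi1997, §17.1] -/
theorem pairRank_add_two_card_le (hρ : 2 ≤ Fintype.card ρ)
    (L : Submodule ℂ (Matrix ρ ρ ℂ × Matrix ρ ρ ℂ)) (hL : ∀ x ∈ L, x.1 * x.2 = 0) :
    pairRank ρ L + 2 * Fintype.card ρ ≤ 2 * Fintype.card ρ ^ 2 := by
  have hM : Module.finrank ℂ (Matrix ρ ρ ℂ) = Fintype.card ρ ^ 2 := by
    rw [Module.finrank_matrix, Module.finrank_self, mul_one, sq]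
  have hsq : 2 * Fintype.card ρ ≤ Fintype.card ρ ^ 2 := by
    rw [sq]; exact Nat.mul_le_mul_right _ hρ
  have hP := Submodule.finrank_le (L.map (LinearMap.fst ℂ (Matrix ρ ρ ℂ) (Matrix ρ ρ ℂ)))
  have hQ := Submodule.finrank_le (L.map (LinearMap.snd ℂ (Matrix ρ ρ ℂ) (Matrix ρ ρ ℂ)))
  rw [hM] at hP hQ
  unfold pairRank
  by_cases hI : ∃ x ∈ L, ∃ B : Matrix ρ ρ ℂ, x.1 * B = 1
  · obtain ⟨x, hx, B, hB⟩ := hI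
    rw [snd_eq_bot_of_unit L hL hx hB, finrank_bot]
    omega
  · by_cases hII : ∃ x ∈ L, ∃ B : Matrix ρ ρ ℂ, x.2 * B = 1
    · obtain ⟨x, hx, B, hB⟩ := hII
      rw [fst_eq_bot_of_unit L hL hx hB, finrank_bot]
      omega
    · -- both projections are singular subspaces: Dieudonné twice
      push Not at hI hII
      have h1 := finrank_add_card_le (L.map (LinearMap.fst ℂ (Matrix ρ ρ ℂ) (Matrix ρ ρ ℂ)))
        fun A hA B hAB => by
          obtain ⟨x, hx, rfl⟩ := Submodule.mem_map.1 hA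
          exact hI x hx B hAB
      have h2 := finrank_add_card_le (L.map (LinearMap.snd ℂ (Matrix ρ ρ ℂ) (Matrix ρ ρ ℂ)))
        fun A hA B hAB => by
          obtain ⟨x, hx, rfl⟩ := Submodule.mem_map.1 hA
          exact hII x hx B hAB
      omega

end Core

/-! ## 2. The format `2^N` and the rate law -/

/-- The core bound `2·4^N − 2·2^N` at format `2^N`.
[cite: BurgisserClausenShokrollahi1997, §17.1] -/
theorem pairRank_le_dieudonne {N : ℕ} (hN : 1 ≤ N)
    (L : Submodule ℂ (Matrix (Fin N → Fin 2) (Fin N → Fin 2) ℂ ×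
      Matrix (Fin N → Fin 2) (Fin N → Fin 2) ℂ))
    (hL : ∀ x ∈ L, x.1 * x.2 = 0) :
    pairRank (Fin N → Fin 2) L ≤ 2 * 4 ^ N - 2 * 2 ^ N := by
  have hcard : Fintype.card (Fin N → Fin 2) = 2 ^ N := by
    simp only [Fintype.card_fun, Fintype.card_fin]
  have hρ : 2 ≤ Fintype.card (Fin N → Fin 2) := by
    rw [hcard]
    exact le_trans (by norm_num) (Nat.pow_le_pow_right (by norm_num) hN)
  have h := pairRank_add_two_card_le hρ L hL
  have h4 : Fintype.card (Fin N → Fin 2) ^ 2 = 4 ^ N := by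
    rw [hcard, ← pow_mul, mul_comm, pow_mul]; norm_num
  rw [h4, hcard] at h
  omega

/-- **Rate law, third rung**: `Amortised N B m ⟹ (2^N + 1)·m ≤ 2^N·B` (`N ≥ 1`).
[cite: CoppersmithWinograd1990, §7] -/
theorem rate_law₃ {N B m : ℕ} (hN : 1 ≤ N) (h : Amortised N B m) :
    (2 ^ N + 1) * m ≤ 2 ^ N * B := by
  have key := level_law hN (Equiv.refl _) (fun L hL => pairRank_le_dieudonne hN L hL) h
  have hn : 2 ≤ 2 ^ N := le_trans (by norm_num) (Nat.pow_le_pow_right (by norm_num) hN)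
  have hK : 4 ^ N = 2 ^ N * 2 ^ N := by
    rw [← mul_pow]; norm_num
  have hnK : 2 * 2 ^ N ≤ 2 * 4 ^ N := by
    rw [hK]; exact Nat.mul_le_mul_left _ (Nat.le_mul_of_pos_left _ (by omega))
  have e : m * (2 * 4 ^ N - 2 * 2 ^ N) + m * (2 * 2 ^ N) = m * (2 * 4 ^ N) := by
    rw [← Nat.mul_add, Nat.sub_add_cancel hnK]
  have e2 : m * (2 * 2 ^ N) = 2 * (m * 2 ^ N) := by ring
  have e3 : m * (2 * 4 ^ N) = 2 * (m * 4 ^ N) := by ring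
  rw [e2, e3] at e
  have key' : 4 * (m * 4 ^ N) ≤ m * (2 * 4 ^ N - 2 * 2 ^ N) + 2 * (B * 4 ^ N) := by
    simpa only [mul_assoc] using key
  have hsum : m * 4 ^ N + m * 2 ^ N ≤ B * 4 ^ N := by omega
  refine Nat.le_of_mul_le_mul_right (c := 2 ^ N) ?_ (by omega)
  have l1 : (2 ^ N + 1) * m * 2 ^ N = m * 4 ^ N + m * 2 ^ N := by rw [hK]; ring
  have l2 : 2 ^ N * B * 2 ^ N = B * 4 ^ N := by rw [hK]; ring
  rw [l1, l2]
  exact hsum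

/-- `(2^N + 1)·m ≤ 2^N·a(N, m)`: the level-`N` rate is at least `1 + 2^{-N}`.
[cite: CoppersmithWinograd1990, §7] -/
theorem rate_amortisedNumber₃ {N : ℕ} (hN : 1 ≤ N) (m : ℕ) :
    (2 ^ N + 1) * m ≤ 2 ^ N * amortisedNumber N m :=
  rate_law₃ hN (amortised_amortisedNumber N m)

/-- Level two: `5m ≤ 4·a(2, m)`. [cite: CoppersmithWinograd1990, §7] -/
theorem level_two_rate₃ (m : ℕ) : 5 * m ≤ 4 * amortisedNumber 2 m := by
  have h := rate_amortisedNumber₃ (by norm_num : 1 ≤ 2) m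
  norm_num at h
  omega

/-- **`a(2,5) ≥ 7`**: `⟨6⟩ ⊠ C₁^{⊠2} ⋭ ⟨5⟩ ⊠ ⟨2,2,2⟩^{⊠2}`. [cite: CoppersmithWinograd1990, §7] -/
theorem amortisedNumber_two_five : 7 ≤ amortisedNumber 2 5 := by
  have h := level_two_rate₃ 5
  omega

/-- **`a(2,6) ≥ 8`**. [cite: CoppersmithWinograd1990, §7] -/
theorem amortisedNumber_two_six : 8 ≤ amortisedNumber 2 6 := by
  have h := level_two_rate₃ 6
  omega

/-- `⟨6⟩ ⊠ C₁^{⊠2} ⋭ ⟨5⟩ ⊠ ⟨2,2,2⟩^{⊠2}`. [cite: CoppersmithWinograd1990, §7] -/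
theorem not_amortised_two_6_5 : ¬ Amortised 2 6 5 := fun h => by
  have e := rate_law₃ (by norm_num : 1 ≤ 2) h
  norm_num at e

/-- Level three: `9m ≤ 8·a(3, m)`. [cite: CoppersmithWinograd1990, §7] -/
theorem level_three_rate₃ (m : ℕ) : 9 * m ≤ 8 * amortisedNumber 3 m := by
  have h := rate_amortisedNumber₃ (by norm_num : 1 ≤ 3) m
  norm_num at h
  omega

end Summit.MatrixMultiplication.MatrixMultiplication.Theorems.OutsiderSandwichLevelRateThree
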